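import Mathlib
import Summits.Ventures.PercRepro2.Defs
import Summits.Ventures.PercRepro2.Independence
import Summits.Ventures.PercRepro2.Harris
import Summits.Ventures.PercRepro2.Graph
import Summits.Ventures.PercRepro2.Exploration
import Summits.Ventures.PercRepro2.Events
import Summits.Ventures.PercRepro2.FourFunctions
import Summits.Ventures.PercRepro2.Induced
import Summits.Ventures.PercRepro2.Frontier
import Summits.Ventures.PercRepro2.ObsIndependence
import Summits.Ventures.PercRepro2.BHK
import Summits.Ventures.PercRepro2.BHKEvents
import Summits.Ventures.PercRepro2.MultiSource
import Summits.Ventures.PercRepro2.OrderPreservation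
import Summits.Ventures.PercRepro2.SeedSet
import Summits.Ventures.PercRepro2.MultiSourceFun
import Summits.Ventures.PercRepro2.CrossRootT
import Summits.Ventures.PercRepro2.VdBKahn
import Summits.Ventures.PercRepro2.HullDefs
import Summits.Ventures.PercRepro2.CCTRootEdge
import Summits.Ventures.PercRepro2.CCTAvoidedEdge
import Summits.Ventures.PercRepro2.R1Rung
import Summits.Ventures.PercRepro2.CC2Rung
import Summits.Ventures.PercRepro2.PASubDefs
import Summits.Ventures.PercRepro2.PASub
import Summits.Ventures.PercRepro2.HalfN
import Summits.Ventures.PercRepro2.PAK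
import Summits.Ventures.PercRepro2.CCTLin
import Summits.Ventures.PercRepro2.BasePrime
import Summits.Ventures.PercRepro2.BasePendant
import Summits.Ventures.PercRepro2.L1KPendant

/-!
# (L1-K) at every edge incident to the avoided set is a theorem (blind cell PercRepro2, typer-1;
row 2′CCT-LIN, the T-edge case — the companion of `L1KPendant` (unmarked pendant edges) and of
`CCTAvoidedEdge.ccT_avoided_edge` ((CC-T) at T-edges, mine-c §9.10 (ii)))

For `e = {t, w}` with `t ∈ T`, the partition sums of (L1-K) are the `e`-open masses
(`L1KPendant.sum_x_lambda_eq`, `sum_lambda_eq`: `Σx₁λ₁ = F₁ᵃ`, `Σλ₁ = P₁`), (PA-K) gives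
`F₁ᵃ F₁ᵇ ≤ Σx₁y₁λ₁ · P₁` (`PAK.paK`), and the shift lemma at a T-edge gives `F₁ᵃ P₀ ≤ F₀ᵃ P₁`
(`CCT.shift_avoided_edge`: opening `e` keeps `s` avoiding `T` iff it avoided `T ∪ {w}`, and
avoiding more lowers the connection probability — vdB–Kahn). The cleared (L1-K) expression `L`
satisfies the exact identity

  `P₁ · L = P₀² (P₁ Σx₁y₁λ₁ − F₁ᵃ F₁ᵇ) + (P₀ F₁ᵃ − P₁ F₀ᵃ)(P₀ F₁ᵇ − P₁ F₀ᵇ)`,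

a sum of a nonnegative and a product of two nonpositive terms; for `P₁ = 0` all `e`-open masses
vanish and `L = 0`. Hence

* **`L1K_avoided_edge`**: (L1-K) holds at every edge `e = {t, w}` with `t ∈ T` (all `n`, all
  weights).

Status of row 2′CCT-LIN, (L1-K): a theorem at T-edges and at unmarked pendant edges; open at the
remaining free edges (root edges included).
-/

namespace Summit.Ventures.PercRepro2

namespace L1KAvoidedEdge

open PASub HalfN TwoSetRung CCTLin

open scoped Classical

variable {V : Type*} {E : Type*} [Fintype E] [DecidableEq E] [Fintype V] [DecidableEq V]
  {R : Type*} [Field R] [LinearOrder R] [IsStrictOrderedRing R]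

variable (p : E → R) (ends : E → Sym2 V) (e : E) (s : V) (T : Finset V)

omit [DecidableEq V] [LinearOrder R] [IsStrictOrderedRing R] in
/-- The exact identity behind the T-edge case: with `Σx₁λ₁ = F₁ᵃ`, `Σy₁λ₁ = F₁ᵇ`, `Σλ₁ = P₁`,
`P₁ · L = P₀² (P₁ Σx₁y₁λ₁ − F₁ᵃ F₁ᵇ) + (P₀ F₁ᵃ − P₁ F₀ᵃ)(P₀ F₁ᵇ − P₁ F₀ᵇ)`. -/
lemma L1K_expr_identity (P₀ P₁ F₀a F₀b F₁a F₁b Sxy : R) :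
    P₁ * (P₀ ^ 2 * Sxy - P₀ * (F₀a * F₁b + F₀b * F₁a) + F₀a * F₀b * P₁) =
      P₀ ^ 2 * (P₁ * Sxy - F₁a * F₁b) + (P₀ * F₁a - P₁ * F₀a) * (P₀ * F₁b - P₁ * F₀b) := by
  ring

/-- **(L1-K) at every edge incident to the avoided set** (`e = {t, w}`, `t ∈ T`). -/
theorem L1K_avoided_edge (hp : IsProbVec p) {t w : V} (hends : ends e = s(t, w)) (ht : t ∈ T)
    (a b : V) : L1K p ends e s T a b := by
  unfold L1K
  have hp₁ : IsProbVec (Function.update p e 1) := hp.update e zero_le_one le_rfl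
  -- the partition sums as `e`-open masses
  have hk := PAK.paK p ends e s T hp a b
  rw [L1KPendant.sum_x_lambda_eq p ends e s T a, L1KPendant.sum_x_lambda_eq p ends e s T b,
    L1KPendant.sum_lambda_eq p ends e s T] at hk ⊢
  -- the shifts at a T-edge: `F₁ᵃ P₀ ≤ F₀ᵃ P₁`
  have ha := CCT.shift_avoided_edge p ends hp hends s ht {a}
  have hb := CCT.shift_avoided_edge p ends hp hends s ht {b}
  -- nonnegativity of the masses and of the partition sum
  have hP₀ : 0 ≤ prob (Function.update p e 0) (avoidAll ends s T) :=
    prob_nonneg (hp.update e le_rfl zero_le_one) _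
  have hSxy : 0 ≤ ∑ W : Set V, if s ∉ W then
      prob p (XdelP ends e s W a) * prob p (XdelP ends e s W b) * prob p (KEvent ends e T W)
      else 0 :=
    Finset.sum_nonneg fun W _ => by
      split_ifs <;> first
        | exact mul_nonneg (mul_nonneg (prob_nonneg hp _) (prob_nonneg hp _)) (prob_nonneg hp _)
        | exact le_rfl
  unfold massP massF at hk ⊢
  set P₀ := prob (Function.update p e 0) (avoidAll ends s T) with hP₀def
  set P₁ := prob (Function.update p e 1) (avoidAll ends s T) with hP₁def
  set F₀a := prob (Function.update p e 0) (avoidAll ends s T ∩ connAll ends s {a}) with hF₀a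
  set F₀b := prob (Function.update p e 0) (avoidAll ends s T ∩ connAll ends s {b}) with hF₀b
  set F₁a := prob (Function.update p e 1) (avoidAll ends s T ∩ connAll ends s {a}) with hF₁a
  set F₁b := prob (Function.update p e 1) (avoidAll ends s T ∩ connAll ends s {b}) with hF₁b
  set Sxy := ∑ W : Set V, if s ∉ W then
      prob p (XdelP ends e s W a) * prob p (XdelP ends e s W b) * prob p (KEvent ends e T W)
      else 0 with hSxydef
  rcases (prob_nonneg hp₁ (avoidAll ends s T)).lt_or_eq with hpos | hzero
  · -- `P₁ > 0`: divide the identity by `P₁`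
    have h1 : 0 ≤ P₀ ^ 2 * (P₁ * Sxy - F₁a * F₁b) :=
      mul_nonneg (sq_nonneg _) (by linarith [hk])
    have h2 : 0 ≤ (P₀ * F₁a - P₁ * F₀a) * (P₀ * F₁b - P₁ * F₀b) :=
      mul_nonneg_of_nonpos_of_nonpos (by linarith [ha]) (by linarith [hb])
    have hmul : 0 ≤ P₁ * (P₀ ^ 2 * Sxy - P₀ * (F₀a * F₁b + F₀b * F₁a) + F₀a * F₀b * P₁) := by
      rw [L1K_expr_identity]
      exact add_nonneg h1 h2
    exact nonneg_of_mul_nonneg_right hmul hpos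
  · -- `P₁ = 0`: every `e`-open mass vanishes
    have hF₁a0 : F₁a = 0 :=
      le_antisymm (hzero ▸ prob_mono hp₁ Set.inter_subset_left) (prob_nonneg hp₁ _)
    have hF₁b0 : F₁b = 0 :=
      le_antisymm (hzero ▸ prob_mono hp₁ Set.inter_subset_left) (prob_nonneg hp₁ _)
    have hSxy0 : Sxy = 0 := by
      refine le_antisymm ?_ hSxy
      have hle : Sxy ≤ ∑ W : Set V, if s ∉ W then prob p (KEvent ends e T W) else 0 := by
        refine Finset.sum_le_sum fun W _ => ?_
        split_ifs
        · exact le_rfl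
        · have hx := prob_le_one hp (XdelP ends e s W a)
          have hy := prob_le_one hp (XdelP ends e s W b)
          have hy0 := prob_nonneg hp (XdelP ends e s W b)
          have hl0 := prob_nonneg hp (KEvent ends e T W)
          calc prob p (XdelP ends e s W a) * prob p (XdelP ends e s W b) * prob p (KEvent ends e T W)
              ≤ 1 * 1 * prob p (KEvent ends e T W) :=
                mul_le_mul_of_nonneg_right (mul_le_mul hx hy hy0 zero_le_one) hl0
            _ = prob p (KEvent ends e T W) := by ring
      rw [L1KPendant.sum_lambda_eq p ends e s T] at hle
      unfold massP at hle
      linarith [hle, hzero]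
    have hP₁0 : P₁ = 0 := by rw [hP₁def]; exact hzero.symm
    rw [hF₁a0, hF₁b0, hSxy0, hP₁0]
    simp

end L1KAvoidedEdge

end Summit.Ventures.PercRepro2
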